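import Summits.Ventures.PercRepro.C041CycleDict3
import Summits.Ventures.PercRepro.C041CycleZone
import Summits.Ventures.PercRepro.C041SquareMarksAll

/-!
# ROW C-041 — THE THREE-EXIT CYCLE ON THE GRAPH MODEL: (P), the one-anchor (CS) and the ZONE O-CUBE for every
cycle with three marked vertices, by name (p6, gen 31; the consequences of THE THREE-EXIT CYCLE DICTIONARY
`sixVec_cyc3` for mine-3's theorems on `thetaSq`)

`cyc3 n i j k Z a Z' a' Z'' a''` is the cycle `C_{n+1}` through the anchor `0` with the zones at `x_i`, `x_j`,
`x_k` (`0 < i < j < k`), and its six-vector IS `thetaSq (2^ℓ₁ − 2) … (2^ℓ₄ − 2) (Π Z) (Π Z') (Π Z'')`.  Hence, on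
the graph model, for EVERY cycle length and EVERY triple of exit positions:

* **THEOREM (CYCLES WITH THREE MARKED VERTICES), graph-model form**: the cycle carrying `p` / `q`, `p'` / `q'`,
  `p''` / `q''` marks at `x_i`, `x_j`, `x_k` is IN THE CONE (`inCone_sixVec_cyc3_point`, from mine-3's
  `InCone_thetaSq_marks_lengths`), hence satisfies the ZONE O-CUBE and the one-anchor (CS)
  (`zoneOCubeConj_cyc3_point`, `zoneCSConj_cyc3_point`) — with no hypothesis;
* **the cycle reduces to the square**: three cone inputs whose square map is in the cone give cone membership of
  every three-exit cycle zone on them (`inCone_sixVec_cyc3_of_square`; mine-3's `InCone_thetaSq_of_InCone_sq`).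
-/

namespace PercRepro

namespace ZoneZ

namespace TwoExit

open ZoneData TreeClosure RelaxedTriangle Finset

variable (n : ℕ) (i j k : Fin (n + 1))

/-- The four arcs have length `≥ 1`. -/
theorem arc_lengths3 (hi : 0 < i.val) (hij : i.val < j.val) (hjk : j.val < k.val) :
    1 ≤ i.val ∧ 1 ≤ j.val - i.val ∧ 1 ≤ k.val - j.val ∧ 1 ≤ n + 1 - k.val := by
  have := k.is_le
  omega

open PointZone in
/-- **The cycle with three marked vertices of any marks is IN THE CONE**. -/
theorem inCone_sixVec_cyc3_point (hi : 0 < i.val) (hij : i.val < j.val) (hjk : j.val < k.val)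
    (p q p' q' p'' q'' : ℕ) :
    InCone ((cyc3 n i j k (pointZone p q) () (pointZone p' q') () (pointZone p'' q'') ()).sixVec
      (Sum.inl (Sum.inl (Sum.inl 0)))) := by
  obtain ⟨h₁, h₂, h₃, h₄⟩ := arc_lengths3 n i j k hi hij hjk
  rw [sixVec_cyc3 n i j k _ _ _ _ _ _ hi hij hjk, sixVec_pointZone, sixVec_pointZone, sixVec_pointZone, one_mul,
    one_mul, one_mul]
  exact InCone_thetaSq_marks_lengths p q p' q' p'' q'' _ _ _ _ h₁ h₂ h₃ h₄

open PointZone in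
/-- **THEOREM (CYCLES WITH THREE MARKED VERTICES), on the graph model**: the ZONE O-CUBE holds on every cycle
through the anchor carrying three marked vertices of any marks. -/
theorem zoneOCubeConj_cyc3_point (hi : 0 < i.val) (hij : i.val < j.val) (hjk : j.val < k.val)
    (p q p' q' p'' q'' : ℕ) :
    (cyc3 n i j k (pointZone p q) () (pointZone p' q') () (pointZone p'' q'') ()).ZoneOCubeConj
      {Sum.inl (Sum.inl (Sum.inl 0))} (∅ : Set (((Fin (n + 1) ⊕ Unit) ⊕ Unit) ⊕ Unit)) :=
  (cyc3 n i j k (pointZone p q) () (pointZone p' q') () (pointZone p'' q'') ()).zoneOCubeConj_of_inCone_sixVec _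
    (inCone_sixVec_cyc3_point n i j k hi hij hjk p q p' q' p'' q'')

open PointZone in
/-- The one-anchor (CS) on every cycle with three marked vertices. -/
theorem zoneCSConj_cyc3_point (hi : 0 < i.val) (hij : i.val < j.val) (hjk : j.val < k.val)
    (p q p' q' p'' q'' : ℕ) :
    (cyc3 n i j k (pointZone p q) () (pointZone p' q') () (pointZone p'' q'') ()).ZoneCSConj
      {Sum.inl (Sum.inl (Sum.inl 0))} (∅ : Set (((Fin (n + 1) ⊕ Unit) ⊕ Unit) ⊕ Unit)) :=
  (cyc3 n i j k (pointZone p q) () (pointZone p' q') () (pointZone p'' q'') ()).zoneCSConj_of_inCone_sixVec _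
    (inCone_sixVec_cyc3_point n i j k hi hij hjk p q p' q' p'' q'')

variable {V E T₁ T₂ V' E' T₁' T₂' V'' E'' T₁'' T₂'' : Type} (Z : ZoneData V E T₁ T₂) (a : V)
  (Z' : ZoneData V' E' T₁' T₂') (a' : V') (Z'' : ZoneData V'' E'' T₁'' T₂'') (a'' : V'')
variable [Fintype E] [DecidableEq E] [Fintype T₁] [DecidableEq T₁] [Fintype T₂] [DecidableEq T₂] [Fintype E']
  [DecidableEq E'] [Fintype T₁'] [DecidableEq T₁'] [Fintype T₂'] [DecidableEq T₂'] [Fintype E''] [DecidableEq E'']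
  [Fintype T₁''] [DecidableEq T₁''] [Fintype T₂''] [DecidableEq T₂'']

/-- **Every three-exit cycle is in the cone as soon as its square map is**: for three cone inputs whose square
map `square (Π Z) (Π Z') (Π Z'')` is in the cone, every cycle zone `cyc3 n i j k Z a Z' a' Z'' a''` is in the
cone (mine-3's `InCone_thetaSq_of_InCone_sq`, through the dictionary). -/
theorem inCone_sixVec_cyc3_of_square (hi : 0 < i.val) (hij : i.val < j.val) (hjk : j.val < k.val)
    (h : InCone (Z.sixVec a)) (h' : InCone (Z'.sixVec a')) (h'' : InCone (Z''.sixVec a''))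
    (hsq : InCone (square (Z.sixVec a) (Z'.sixVec a') (Z''.sixVec a''))) :
    InCone ((cyc3 n i j k Z a Z' a' Z'' a'').sixVec (Sum.inl (Sum.inl (Sum.inl 0)))) := by
  obtain ⟨h₁, h₂, h₃, h₄⟩ := arc_lengths3 n i j k hi hij hjk
  rw [sixVec_cyc3 n i j k Z a Z' a' Z'' a'' hi hij hjk]
  exact InCone_thetaSq_of_InCone_sq h h' h'' hsq (mixed_mult_nonneg _ h₁) (mixed_mult_nonneg _ h₂)
    (mixed_mult_nonneg _ h₃) (mixed_mult_nonneg _ h₄)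

/-- The ZONE O-CUBE on every three-exit cycle whose square map is in the cone (cone inputs). -/
theorem zoneOCubeConj_cyc3_of_square (hi : 0 < i.val) (hij : i.val < j.val) (hjk : j.val < k.val)
    (h : InCone (Z.sixVec a)) (h' : InCone (Z'.sixVec a')) (h'' : InCone (Z''.sixVec a''))
    (hsq : InCone (square (Z.sixVec a) (Z'.sixVec a') (Z''.sixVec a''))) :
    (cyc3 n i j k Z a Z' a' Z'' a'').ZoneOCubeConj {Sum.inl (Sum.inl (Sum.inl 0))}
      (∅ : Set (((Fin (n + 1) ⊕ V') ⊕ V) ⊕ V'')) :=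
  (cyc3 n i j k Z a Z' a' Z'' a'').zoneOCubeConj_of_inCone_sixVec _
    (inCone_sixVec_cyc3_of_square n i j k Z a Z' a' Z'' a'' hi hij hjk h h' h'' hsq)


/-! ## The square map is the six-vector of the four-cycle -/

/-- **THE SQUARE MAP IS THE SIX-VECTOR OF THE FOUR-CYCLE** with three hanging zones: at `n = 3`, exits `1 < 2 < 3`,
every arc has length `1` and multiplicity `2^1 − 2 = 0`, so `thetaSq 0 0 0 0 = square` (mine-3's `thetaSq_eq`). -/
theorem sixVec_cyc3_square :
    (cyc3 3 1 2 3 Z a Z' a' Z'' a'').sixVec (Sum.inl (Sum.inl (Sum.inl 0))) =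
      square (Z.sixVec a) (Z'.sixVec a') (Z''.sixVec a'') := by
  rw [sixVec_cyc3 3 1 2 3 Z a Z' a' Z'' a'' (by decide) (by decide) (by decide), thetaSq_eq]
  have h1 : ((2 : ℝ) ^ (1 : Fin 4).val - 2) = 0 := by norm_num
  have h2 : ((2 : ℝ) ^ ((2 : Fin 4).val - (1 : Fin 4).val) - 2) = 0 := by norm_num
  have h3 : ((2 : ℝ) ^ ((3 : Fin 4).val - (2 : Fin 4).val) - 2) = 0 := by norm_num
  have h4 : ((2 : ℝ) ^ (3 + 1 - (3 : Fin 4).val) - 2) = 0 := by norm_num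
  rw [h1, h2, h3, h4]
  simp only [zero_mul, mul_zero, zero_smul, add_zero]

end TwoExit

end ZoneZ

end PercRepro
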